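import Literature.NumberTheory.Transcendental.RoyPadicRankCategory
import Literature.Barriers.Schanuel.AlgebraicIndependenceOfLogarithmsRoyThm2bis
import HarnessLib

/-!
# Roy 1992 for `K = ℚ̄_p`: Propositions 1–3 for the category `𝒞` and Theorem 2 from Theorem 1 (§§2–3)

Topic `Literature/NumberTheory/Transcendental` (namespace `Literature.NumberTheory.Transcendental`,
grouping sub-namespace `RoyPadic`). Sequel of `RoyPadicRankCategory` (vocabulary of Theorems 1–2,
objects and morphisms of Roy's category `𝒞` for `K = ℚ̄_p = PadicAlgCl p`). This file is the
`p`-adic port of `Literature.Barriers.Schanuel.AlgebraicIndependenceOfLogarithmsRoyKernels` and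
`…RoyThm2FromThm1` (the complex case), with `Ω = 0` (`ω = 0` for the `p`-adic field, Notations
p. 24), which makes Roy's function `a` equal to `d₁` and Proposition 3 trivial. Everything is proved;
NO named fact is introduced: Theorem 1 (Waldschmidt) is the hypothesis
`∀ d₀ d₁ Y W V, IsThmOneDatum Y W V → V ≠ ⊤ → ThmOneConclusion Y W V`.

## Contents

* the `ℚ̄`-structure `ℚ̄^{d₀} × ℚ̄^{d₁}` (`qPts`), base change `dim_K(K·S) = dim_ℚ̄ S`, rationality by
  dimension, intersections / ranges / preimages of rational subspaces, reflection of `ℚ̄`-points by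
  injective morphisms, the rational left inverse of the `ℚ`-block;
* the preimage object `comapObj` and **Proposition 1** (kernels have cokernels and conversely):
  `RoyPadic.cat p : AdmissibleCat (Obj p)` — the field-free abstract admissible category and
  Theorem 3 of `Literature.Barriers.Schanuel.AlgebraicIndependenceOfLogarithmsRoyThm3` are REUSED;
* **Proposition 2** (`b, c, d, r, d₀, d₁` additive, `a` upper additive — here `a = d₁`), packaged as
  `Obj.thm3Hyp`; **Proposition 3** (`Obj.prop3`, the identity cokernel since `a = d₁`);
  **Theorem 1bis** from the hypothesis "Theorem 1" (`Obj.statement1_of_thmOne`);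
* **Theorem 2 from Theorem 1** (`RoyPadic.thmTwo_of_thmOne`): the abstract Theorem 2bis
  (`Roy1992.AdmissibleCat.thm2bis`, field-free, REUSED) read back through the dictionary of
  `RoyPadicRankCategory` (`thm2Ratio = d₁(X')/b(X')`, bad kernels ⟺ `s(V) ∩ (ℚ̄^{d₀'} × 0) ≠ 0`),
  exactly as in the complex-case `roy1992_thm2_of_thm1`.

## What the source prints [Roy1992, §2 pp. 26–29, §3 pp. 32–34]

Proposition 1 (p. 27: "Any kernel of `𝒞` admits a cokernel in `𝒞` and, vice versa, any cokernel of
`𝒞` admits a kernel in `𝒞`. The set of all kernels of `𝒞` and the set of its cokernels are closed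
under composition."), Proposition 2 (p. 28: "The function `a` is upper additive while `b, c, d, r,
d₀`, and `d₁` are additive. These functions vanish on each object on which `r` vanishes."),
Proposition 3 (p. 28: "The function `a` is bounded above by `d₁`. For each object `X` of `𝒞`, there
exists a cokernel `s : X → X'` with domain `X` such that `d₁(X') ≤ a(X)` and `b(X') = b(X)`."),
Theorem 1bis and Theorem 2bis (p. 27), and the proof of Theorem 2bis from Theorem 3 (pp. 32–34).

## References

* [Roy1992] D. Roy, *Matrices whose coefficients are linear forms in logarithms*, J. Number
  Theory 41 (1992) 22–47: Notations (p. 24); §1 Theorem 2 (p. 25); §2 Propositions 1–3, Theorems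
  1bis–2bis (pp. 26–29); §3 proof of Theorem 2bis (pp. 32–34).
* [Waldschmidt1988] M. Waldschmidt, *On the transcendence methods of Gel'fond and Schneider in
  several variables*, New Advances in Transcendence Theory (1988), §4 Theorem 4.1.
-/

noncomputable section

namespace Literature.NumberTheory.Transcendental.RoyPadic

open Module Submodule
open Literature.Barriers.Schanuel.Roy1992 (incl incl_apply incl_injective spanK spanK_span finrank_spanK
  linearIndependent_incl_comp eq_span_range_basis map_mulVec_incl ker_mulVecLin_map
  exists_surjective_ker_eq_spanK exists_injective_range_eq_spanK range_mulVecLin_map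
  exists_leftInverse_map finrank_map_add_finrank_comap finrank_prod_eq AdmissibleCat)

variable {p : ℕ} [Fact p.Prime]

section PartB

variable {d₀ d₁ a₀ a₁ : ℕ}


/-! ### Flattening `K^{d₀} × K^{d₁} ≃ K^{d₀ + d₁}` -/

/-- The coordinate identification `K^{d₀} × K^{d₁} ≃ K^{d₀+d₁}` (first the `d₀` coordinates, then
the `d₁`). [folklore] -/
def flat (d₀ d₁ : ℕ) : LinTangent p d₀ d₁ ≃ₗ[PadicAlgCl p] (Fin (d₀ + d₁) → PadicAlgCl p) where
  toFun v := Fin.append v.1 v.2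
  invFun w := (fun i => w (Fin.castAdd d₁ i), fun j => w (Fin.natAdd d₀ j))
  map_add' v w := by
    funext k
    refine Fin.addCases (fun i => ?_) (fun j => ?_) k <;> simp
  map_smul' c v := by
    funext k
    refine Fin.addCases (fun i => ?_) (fun j => ?_) k <;> simp
  left_inv v := by
    ext i <;> simp
  right_inv w := by
    funext k
    refine Fin.addCases (fun i => ?_) (fun j => ?_) k <;> simp

/-- Coordinates of `flat v`. [folklore] -/
theorem forall_flat_mem_iff (S : Set (PadicAlgCl p)) (v : LinTangent p d₀ d₁) :
    (∀ k, flat d₀ d₁ v k ∈ S) ↔ (∀ i, v.1 i ∈ S) ∧ ∀ j, v.2 j ∈ S := by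
  constructor
  · intro h
    refine ⟨fun i => ?_, fun j => ?_⟩
    · simpa [flat] using h (Fin.castAdd d₁ i)
    · simpa [flat] using h (Fin.natAdd d₀ j)
  · rintro ⟨h1, h2⟩ k
    refine Fin.addCases (fun i => ?_) (fun j => ?_) k
    · simpa [flat] using h1 i
    · simpa [flat] using h2 j

/-- `ℚ̄`-points are the vectors with algebraic flat coordinates. [folklore] -/
theorem isQbarPoint_iff_flat (v : LinTangent p d₀ d₁) :
    IsQbarPoint v ↔ ∀ k, flat d₀ d₁ v k ∈ (padicQbar p) :=
  (forall_flat_mem_iff _ v).symm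

/-! ### The `ℚ̄`-structure `ℚ̄^{d₀} × ℚ̄^{d₁}` and base change -/

/-- The `ℚ̄`-points `ℚ̄^{d₀} × ℚ̄^{d₁}` of `K^{d₀} × K^{d₁}`, as a `ℚ̄`-subspace.
[cite: Roy1992, Notations (p. 24)] -/
def qPts (p : ℕ) [Fact p.Prime] (d₀ d₁ : ℕ) : Submodule (padicQbar p) (LinTangent p d₀ d₁) where
  carrier := {v | IsQbarPoint v}
  add_mem' := by
    rintro v w ⟨hv1, hv2⟩ ⟨hw1, hw2⟩
    exact ⟨fun i => add_mem (hv1 i) (hw1 i), fun j => add_mem (hv2 j) (hw2 j)⟩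
  zero_mem' := ⟨fun _ => zero_mem _, fun _ => zero_mem _⟩
  smul_mem' := by
    rintro c v ⟨hv1, hv2⟩
    refine ⟨fun i => ?_, fun j => ?_⟩
    · rw [Prod.smul_fst, Pi.smul_apply, IntermediateField.smul_def, smul_eq_mul]
      exact mul_mem c.2 (hv1 i)
    · rw [Prod.smul_snd, Pi.smul_apply, IntermediateField.smul_def, smul_eq_mul]
      exact mul_mem c.2 (hv2 j)

/-- Membership in `qPts`. [folklore] -/
@[simp] theorem mem_qPts {v : LinTangent p d₀ d₁} : v ∈ qPts p d₀ d₁ ↔ IsQbarPoint v := Iff.rfl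

/-- `ℚ̄^{d₀} × ℚ̄^{d₁}` is the image of the coordinatewise inclusion. [folklore] -/
theorem qPts_eq_range (d₀ d₁ : ℕ) :
    qPts p d₀ d₁ = LinearMap.range ((incl (padicQbar p) (PadicAlgCl p) d₀).prodMap (incl (padicQbar p) (PadicAlgCl p) d₁)) := by
  ext v
  rw [mem_qPts, LinearMap.mem_range]
  constructor
  · rintro ⟨h1, h2⟩
    exact ⟨(fun i => ⟨v.1 i, h1 i⟩, fun j => ⟨v.2 j, h2 j⟩), rfl⟩
  · rintro ⟨w, rfl⟩
    exact ⟨fun i => SetLike.coe_mem _, fun j => SetLike.coe_mem _⟩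

/-- `ℚ̄^{d₀} × ℚ̄^{d₁}` is finite dimensional over `ℚ̄`. [folklore] -/
instance instFiniteQPts (d₀ d₁ : ℕ) : Module.Finite (padicQbar p) (qPts p d₀ d₁) := by
  rw [qPts_eq_range]
  infer_instance

/-- The standard basis vectors are `ℚ̄`-points, so `K · (ℚ̄^{d₀} × ℚ̄^{d₁}) = K^{d₀} × K^{d₁}`. [folklore] -/
theorem span_qPts_eq_top (d₀ d₁ : ℕ) :
    span (PadicAlgCl p) (qPts p d₀ d₁ : Set (LinTangent p d₀ d₁)) = ⊤ := by
  rw [eq_top_iff, ← ((Pi.basisFun (PadicAlgCl p) (Fin d₀)).prod (Pi.basisFun (PadicAlgCl p) (Fin d₁))).span_eq]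
  refine span_mono ?_
  rintro _ ⟨k, rfl⟩
  rcases k with i | j
  · refine ⟨fun i' => ?_, fun j' => ?_⟩
    · rw [Basis.prod_apply_inl_fst, Pi.basisFun_apply]
      by_cases h : i' = i
      · subst h; simp
      · simp [h]
    · rw [Basis.prod_apply_inl_snd]
      exact zero_mem _
  · refine ⟨fun i' => ?_, fun j' => ?_⟩
    · rw [Basis.prod_apply_inr_fst]
      exact zero_mem _
    · rw [Basis.prod_apply_inr_snd, Pi.basisFun_apply]
      by_cases h : j' = j
      · subst h; simp
      · simp [h]

/-- **Base change `ℚ̄ → K` on `K^{d₀} × K^{d₁}`**: a `ℚ̄`-subspace `S` of `ℚ̄`-points spans over `K`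
a subspace of the same dimension, `dim_K (K·S) = dim_ℚ̄ S` (a `ℚ̄`-basis of `S` stays
`K`-independent, `Roy1995.linearIndependent_algebraMap_pi` after flattening). [folklore] -/
theorem finrank_span_eq_of_le_qPts (S : Submodule (padicQbar p) (LinTangent p d₀ d₁)) (hS : S ≤ qPts p d₀ d₁) :
    finrank (PadicAlgCl p) (span (PadicAlgCl p) (S : Set (LinTangent p d₀ d₁))) = finrank (padicQbar p) S := by
  haveI : Module.Finite (padicQbar p) S :=
    Module.Finite.of_injective (Submodule.inclusion hS) (Submodule.inclusion_injective hS)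
  set n := finrank (padicQbar p) S
  let b : Basis (Fin n) (padicQbar p) S := finBasis (padicQbar p) S
  have hb : LinearIndependent (padicQbar p) (fun i => (b i : LinTangent p d₀ d₁)) :=
    b.linearIndependent.map' S.subtype S.ker_subtype
  -- the flattened vectors have algebraic coordinates
  let w : Fin n → Fin (d₀ + d₁) → (padicQbar p) := fun i k =>
    ⟨flat d₀ d₁ (b i : LinTangent p d₀ d₁) k, (isQbarPoint_iff_flat _).1 (hS (b i).2) k⟩
  have hw : incl (padicQbar p) (PadicAlgCl p) (d₀ + d₁) ∘ w = flat d₀ d₁ ∘ fun i => (b i : LinTangent p d₀ d₁) := by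
    funext i k
    rfl
  have hwli : LinearIndependent (padicQbar p) w := by
    apply LinearIndependent.of_comp (incl (padicQbar p) (PadicAlgCl p) (d₀ + d₁))
    rw [hw]
    exact hb.map' ((flat d₀ d₁).toLinearMap.restrictScalars (padicQbar p))
      (LinearMap.ker_eq_bot.2 (flat d₀ d₁).injective)
  have hK : LinearIndependent (PadicAlgCl p) (incl (padicQbar p) (PadicAlgCl p) (d₀ + d₁) ∘ w) := linearIndependent_incl_comp hwli
  rw [hw] at hK
  have hbK : LinearIndependent (PadicAlgCl p) (fun i => (b i : LinTangent p d₀ d₁)) :=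
    LinearIndependent.of_comp (flat d₀ d₁).toLinearMap hK
  have hspan : span (PadicAlgCl p) (S : Set (LinTangent p d₀ d₁)) =
      span (PadicAlgCl p) (Set.range fun i => (b i : LinTangent p d₀ d₁)) := by
    refine le_antisymm ?_ (span_mono ?_)
    · rw [span_le]
      intro v hv
      have hT := eq_span_range_basis S b
      have hv' : v ∈ span (padicQbar p) (Set.range fun i => (b i : LinTangent p d₀ d₁)) := by
        rw [← hT]; exact hv
      exact span_le_restrictScalars (padicQbar p) (PadicAlgCl p) _ hv'
    · rintro _ ⟨i, rfl⟩
      exact (b i).2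
  rw [hspan, finrank_span_eq_card hbK, Fintype.card_fin]

/-- `dim_ℚ̄ (ℚ̄^{d₀} × ℚ̄^{d₁}) = d₀ + d₁`. [folklore] -/
theorem finrank_qPts (d₀ d₁ : ℕ) : finrank (padicQbar p) (qPts p d₀ d₁) = d₀ + d₁ := by
  rw [← finrank_span_eq_of_le_qPts (qPts p d₀ d₁) le_rfl, span_qPts_eq_top, finrank_top,
    finrank_linTangent]

/-- The `ℚ̄`-points of a `K`-subspace `T`: `T ∩ (ℚ̄^{d₀} × ℚ̄^{d₁})` as a `ℚ̄`-subspace.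
[cite: Roy1992, Notations (p. 24)] -/
def qOf (T : Submodule (PadicAlgCl p) (LinTangent p d₀ d₁)) : Submodule (padicQbar p) (LinTangent p d₀ d₁) :=
  T.restrictScalars (padicQbar p) ⊓ qPts p d₀ d₁

/-- Membership in `qOf`. [folklore] -/
@[simp] theorem mem_qOf {T : Submodule (PadicAlgCl p) (LinTangent p d₀ d₁)} {v : LinTangent p d₀ d₁} :
    v ∈ qOf T ↔ v ∈ T ∧ IsQbarPoint v := Iff.rfl

/-- `qOf T ⊆ ℚ̄^{d₀} × ℚ̄^{d₁}`. [folklore] -/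
theorem qOf_le_qPts (T : Submodule (PadicAlgCl p) (LinTangent p d₀ d₁)) : qOf T ≤ qPts p d₀ d₁ := inf_le_right

/-- `qOf T` is finite dimensional over `ℚ̄`. [folklore] -/
instance instFiniteQOf (T : Submodule (PadicAlgCl p) (LinTangent p d₀ d₁)) : Module.Finite (padicQbar p) (qOf T) :=
  Module.Finite.of_injective (Submodule.inclusion (qOf_le_qPts T))
    (Submodule.inclusion_injective _)

/-- The set of `ℚ̄`-points of `T` used in `IsQbarRational`. [folklore] -/
theorem coe_qOf (T : Submodule (PadicAlgCl p) (LinTangent p d₀ d₁)) :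
    (qOf T : Set (LinTangent p d₀ d₁)) = {v | v ∈ T ∧ IsQbarPoint v} := rfl

/-- `T` is rational over `ℚ̄` iff `T = K · qOf T`. [cite: Roy1992, Notations (p. 24)] -/
theorem isQbarRational_iff_eq_span (T : Submodule (PadicAlgCl p) (LinTangent p d₀ d₁)) :
    IsQbarRational T ↔ T = span (PadicAlgCl p) (qOf T : Set (LinTangent p d₀ d₁)) := Iff.rfl

/-- `K · qOf T ⊆ T`. [folklore] -/
theorem span_qOf_le (T : Submodule (PadicAlgCl p) (LinTangent p d₀ d₁)) :
    span (PadicAlgCl p) (qOf T : Set (LinTangent p d₀ d₁)) ≤ T :=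
  span_le.2 fun _ hv => hv.1

/-- `dim_ℚ̄ qOf T ≤ dim_K T`. [folklore] -/
theorem finrank_qOf_le (T : Submodule (PadicAlgCl p) (LinTangent p d₀ d₁)) :
    finrank (padicQbar p) (qOf T) ≤ finrank (PadicAlgCl p) T := by
  rw [← finrank_span_eq_of_le_qPts (qOf T) (qOf_le_qPts T)]
  exact Submodule.finrank_mono (span_qOf_le T)

/-- **Rationality by dimension**: `T` is rational over `ℚ̄` iff `dim_K T ≤ dim_ℚ̄ (qOf T)`
(iff equality). [folklore] -/
theorem isQbarRational_iff_finrank_le (T : Submodule (PadicAlgCl p) (LinTangent p d₀ d₁)) :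
    IsQbarRational T ↔ finrank (PadicAlgCl p) T ≤ finrank (padicQbar p) (qOf T) := by
  rw [← finrank_span_eq_of_le_qPts (qOf T) (qOf_le_qPts T), isQbarRational_iff_eq_span]
  constructor
  · intro h
    rw [← h]
  · intro h
    exact (Submodule.eq_of_le_of_finrank_le (span_qOf_le T) h).symm

/-- **The intersection of two subspaces rational over `ℚ̄` is rational over `ℚ̄`**
(`qOf (T₁ ∩ T₂) = qOf T₁ ∩ qOf T₂` and a dimension count with `K · (qOf T₁ + qOf T₂) ⊆ T₁ + T₂`).
[folklore] -/
theorem isQbarRational_inf {T₁ T₂ : Submodule (PadicAlgCl p) (LinTangent p d₀ d₁)} (h₁ : IsQbarRational T₁)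
    (h₂ : IsQbarRational T₂) : IsQbarRational (T₁ ⊓ T₂) := by
  rw [isQbarRational_iff_finrank_le] at h₁ h₂ ⊢
  have hq : qOf (T₁ ⊓ T₂) = qOf T₁ ⊓ qOf T₂ := by
    ext v
    simp only [mem_qOf, mem_inf]
    tauto
  have hsup : finrank (padicQbar p) ↥(qOf T₁ ⊔ qOf T₂) ≤ finrank (PadicAlgCl p) ↥(T₁ ⊔ T₂) := by
    rw [← finrank_span_eq_of_le_qPts (qOf T₁ ⊔ qOf T₂) (sup_le (qOf_le_qPts T₁) (qOf_le_qPts T₂))]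
    apply Submodule.finrank_mono
    rw [span_le]
    intro v hv
    obtain ⟨x, hx, y, hy, rfl⟩ := Submodule.mem_sup.1 hv
    exact Submodule.mem_sup.2 ⟨x, hx.1, y, hy.1, rfl⟩
  have e1 := Submodule.finrank_sup_add_finrank_inf_eq (qOf T₁) (qOf T₂)
  have e2 := Submodule.finrank_sup_add_finrank_inf_eq T₁ T₂
  rw [hq]
  omega

/-! ### Morphisms and `ℚ̄`-points: images, ranges, reflection, preimages -/

variable {f : LinTangent p a₀ a₁ →ₗ[PadicAlgCl p] LinTangent p d₀ d₁}

/-- The range of a morphism is rational over `ℚ̄` (it is spanned by the images of the standard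
basis vectors, which are `ℚ̄`-points). [folklore] -/
theorem IsBiRational.isQbarRational_range (hf : IsBiRational f) :
    IsQbarRational (LinearMap.range f) := by
  rw [isQbarRational_iff_eq_span]
  have h : LinearMap.range f = span (PadicAlgCl p) (f '' (qPts p a₀ a₁ : Set (LinTangent p a₀ a₁))) := by
    rw [← map_span, span_qPts_eq_top, ← LinearMap.range_eq_map]
  refine le_antisymm ?_ (span_qOf_le _)
  nth_rewrite 1 [h]
  refine span_mono ?_
  rintro _ ⟨v, hv, rfl⟩
  exact ⟨LinearMap.mem_range_self f v, hf.isQbarPoint hv⟩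

/-- **An injective morphism reflects `ℚ̄`-points**: if `f x ∈ ℚ̄^{d₀} × ℚ̄^{d₁}` then
`x ∈ ℚ̄^{a₀} × ℚ̄^{a₁}` (the `ℚ̄`-points of `range f` are the images of the `ℚ̄`-points, by
counting dimensions). [folklore] -/
theorem IsBiRational.isQbarPoint_of_apply (hf : IsBiRational f) (hinj : Function.Injective f)
    {x : LinTangent p a₀ a₁} (hx : IsQbarPoint (f x)) : IsQbarPoint x := by
  set M : Submodule (padicQbar p) (LinTangent p d₀ d₁) := (qPts p a₀ a₁).map (f.restrictScalars (padicQbar p)) with hM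
  have hMle : M ≤ qOf (LinearMap.range f) := by
    rintro _ ⟨v, hv, rfl⟩
    exact ⟨LinearMap.mem_range_self f v, hf.isQbarPoint hv⟩
  have hfinM : finrank (padicQbar p) M = a₀ + a₁ := by
    rw [hM, ← finrank_qPts (p := p) a₀ a₁]
    exact (LinearEquiv.finrank_eq (Submodule.equivMapOfInjective _
      (show Function.Injective (f.restrictScalars (padicQbar p)) from hinj) (qPts p a₀ a₁))).symm
  have hfinR : finrank (padicQbar p) (qOf (LinearMap.range f)) ≤ a₀ + a₁ := by
    refine (finrank_qOf_le _).trans ?_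
    rw [LinearMap.finrank_range_of_inj hinj, finrank_linTangent]
  have hMeq : M = qOf (LinearMap.range f) :=
    Submodule.eq_of_le_of_finrank_le hMle (by rw [hfinM]; exact hfinR)
  have hx' : f x ∈ qOf (LinearMap.range f) := ⟨LinearMap.mem_range_self f x, hx⟩
  rw [← hMeq, hM] at hx'
  obtain ⟨y, hy, hyx⟩ := hx'
  rw [← hinj hyx]
  exact hy

/-- **Preimages of rational subspaces under injective morphisms are rational over `ℚ̄`**
(`i⁻¹(W) = i⁻¹(W ∩ range i)`, `W ∩ range i` is rational, and its `ℚ̄`-points pull back to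
`ℚ̄`-points). [cite: Roy1992, §2 Proposition 1 (p. 27)] -/
theorem IsBiRational.isQbarRational_comap (hf : IsBiRational f) (hinj : Function.Injective f)
    {W : Submodule (PadicAlgCl p) (LinTangent p d₀ d₁)} (hW : IsQbarRational W) : IsQbarRational (W.comap f) := by
  have hR := isQbarRational_inf hW hf.isQbarRational_range
  rw [isQbarRational_iff_eq_span] at hR ⊢
  refine le_antisymm (fun x hx => ?_) (span_qOf_le _)
  have hfx : f x ∈ W ⊓ LinearMap.range f := ⟨hx, LinearMap.mem_range_self f x⟩
  rw [hR] at hfx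
  have hle : span (PadicAlgCl p) (qOf (W ⊓ LinearMap.range f) : Set (LinTangent p d₀ d₁)) ≤
      (span (PadicAlgCl p) (qOf (W.comap f) : Set (LinTangent p a₀ a₁))).map f := by
    rw [span_le]
    rintro v ⟨⟨hvW, ⟨y, rfl⟩⟩, hvq⟩
    exact ⟨y, subset_span ⟨hvW, hf.isQbarPoint_of_apply hinj hvq⟩, rfl⟩
  exact (Submodule.comap_map_eq_of_injective hinj _).le (hle hfx)

/-- Preimages of `ℚ`-subspaces of `ℚ̄^{d₀} × L^{d₁}` under injective morphisms are contained in
`ℚ̄^{a₀} × L^{a₁}` (first block: reflection of `ℚ̄`-points; second block: a rational left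
inverse, `L` being a `ℚ`-subspace). [cite: Roy1992, §2 Proposition 1 (p. 27)] -/
theorem IsBiRational.isQbarLogSubspace_comap (hf : IsBiRational f) (hinj : Function.Injective f)
    {Y : Submodule ℚ (LinTangent p d₀ d₁)} (hY : IsQbarLogSubspace Y) :
    IsQbarLogSubspace (Y.comap (f.restrictScalars ℚ)) := by
  obtain ⟨B₀, B₁, hdec⟩ := exists_eq_prodMap_of_isBiRational hf
  intro y hy
  obtain ⟨h1, h2⟩ := hY _ hy
  refine ⟨fun i => ?_, fun j => ?_⟩
  · -- `f (y.1, 0) = (B₀ y.1, 0)` is a `ℚ̄`-point, hence so is `(y.1, 0)`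
    have hpt : IsQbarPoint (f (y.1, 0)) := by
      have hf1 : (f (y.1, 0)).1 = (f y).1 := by
        rw [hdec, LinearMap.prodMap_apply, LinearMap.prodMap_apply]
      refine ⟨fun k => ?_, fun k => ?_⟩
      · rw [hf1]; exact h1 k
      · rw [hdec, LinearMap.prodMap_apply, map_zero]
        exact zero_mem _
    exact (hf.isQbarPoint_of_apply hinj hpt).1 i
  · -- `y.2 = C₁ (B₁ y.2)` with `C₁` rational and `B₁ y.2 ∈ L^{d₁}`
    have hinj₁ : Function.Injective (B₁.map (algebraMap ℚ (PadicAlgCl p))).mulVecLin := by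
      intro z z' hzz'
      have : f (0, z) = f (0, z') := by
        rw [hdec, LinearMap.prodMap_apply, LinearMap.prodMap_apply, hzz']
      exact congrArg Prod.snd (hinj this)
    obtain ⟨C₁, hC₁⟩ := exists_leftInverse_map B₁ hinj₁
    have hy2 : y.2 = (C₁.map (algebraMap ℚ (PadicAlgCl p))).mulVec ((f y).2) := by
      rw [hdec]
      simp only [LinearMap.prodMap_apply, Matrix.mulVecLin_apply, Matrix.mulVec_mulVec, hC₁,
        Matrix.one_mulVec]
    rw [hy2]
    simp only [Matrix.mulVec, dotProduct, Matrix.map_apply]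
    refine sum_mem fun k _ => ?_
    rw [Algebra.algebraMap_eq_smul_one, smul_mul_assoc, one_mul]
    exact Submodule.smul_mem _ _ (h2 k)

/-! ### The preimage object of a kernel -/

namespace Obj

/-- **The preimage object** `X* = (K^{a₀} × K^{a₁}, i⁻¹(Y), i⁻¹(W), i⁻¹(V))` of an injective
morphism `i` (used in Proposition 1: "any cokernel of `𝒞` admits a kernel in `𝒞`").
[cite: Roy1992, §2 Proposition 1 (p. 27)] -/
def comapObj (X : Obj p) (i : LinTangent p a₀ a₁ →ₗ[PadicAlgCl p] LinTangent p X.d₀ X.d₁)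
    (hinj : Function.Injective i) (hi : IsBiRational i) : Obj p where
  d₀ := a₀
  d₁ := a₁
  Y := X.Y.comap (i.restrictScalars ℚ)
  W := X.W.comap i
  V := X.V.comap i
  finite := by
    refine Module.Finite.of_injective
      ((i.restrictScalars ℚ).restrict (p := X.Y.comap (i.restrictScalars ℚ)) (q := X.Y)
        fun x hx => hx) ?_
    intro x y hxy
    apply Subtype.ext
    apply hinj
    have := congrArg Subtype.val hxy
    simpa using this
  isLog := hi.isQbarLogSubspace_comap hinj X.isLog
  isRat := hi.isQbarRational_comap hinj X.isRat
  hYV := fun _ hy => X.hYV hy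
  hWV := Submodule.comap_mono X.hWV

/-- `X*` lives in `K^{a₀} × K^{a₁}`. [folklore] -/
@[simp] theorem comapObj_d₀ (X : Obj p) (i : LinTangent p a₀ a₁ →ₗ[PadicAlgCl p] LinTangent p X.d₀ X.d₁)
    (hinj : Function.Injective i) (hi : IsBiRational i) : (X.comapObj i hinj hi).d₀ = a₀ := rfl

/-- `X*` lives in `K^{a₀} × K^{a₁}`. [folklore] -/
@[simp] theorem comapObj_d₁ (X : Obj p) (i : LinTangent p a₀ a₁ →ₗ[PadicAlgCl p] LinTangent p X.d₀ X.d₁)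
    (hinj : Function.Injective i) (hi : IsBiRational i) : (X.comapObj i hinj hi).d₁ = a₁ := rfl

/-- `Y* = i⁻¹(Y)`. [cite: Roy1992, §2 (p. 26)] -/
@[simp] theorem comapObj_Y (X : Obj p) (i : LinTangent p a₀ a₁ →ₗ[PadicAlgCl p] LinTangent p X.d₀ X.d₁)
    (hinj : Function.Injective i) (hi : IsBiRational i) :
    (X.comapObj i hinj hi).Y = X.Y.comap (i.restrictScalars ℚ) := rfl

/-- `W* = i⁻¹(W)`. [cite: Roy1992, §2 (p. 26)] -/
@[simp] theorem comapObj_W (X : Obj p) (i : LinTangent p a₀ a₁ →ₗ[PadicAlgCl p] LinTangent p X.d₀ X.d₁)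
    (hinj : Function.Injective i) (hi : IsBiRational i) :
    (X.comapObj i hinj hi).W = X.W.comap i := rfl

/-- `V* = i⁻¹(V)`. [cite: Roy1992, §2 (p. 26)] -/
@[simp] theorem comapObj_V (X : Obj p) (i : LinTangent p a₀ a₁ →ₗ[PadicAlgCl p] LinTangent p X.d₀ X.d₁)
    (hinj : Function.Injective i) (hi : IsBiRational i) :
    (X.comapObj i hinj hi).V = X.V.comap i := rfl

/-- `(X*, X, i)` is a kernel for every injective morphism `i`. [cite: Roy1992, §2 Proposition 1 (p. 27)] -/
theorem isKerMap_comapObj (X : Obj p) {i : LinTangent p a₀ a₁ →ₗ[PadicAlgCl p] LinTangent p X.d₀ X.d₁}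
    (hinj : Function.Injective i) (hi : IsBiRational i) : (X.comapObj i hinj hi).IsKerMap X i :=
  ⟨hinj, hi, rfl, rfl, rfl⟩

end Obj

/-! ### Proposition 1: kernels have cokernels and cokernels have kernels -/

namespace Obj

/-- **Proposition 1, first half**: every kernel `(X*, X, i)` admits a cokernel `(X, X', s)` with
`Im(i) = ker(s)` (`Im(i) = S₀ × S₁` with `S₀` rational over `ℚ̄`, `S₁` rational over `ℚ`; take
`s = t₀ × t₁` with rational surjections `t₀, t₁` of kernels `S₀, S₁`).
[cite: Roy1992, §2 Proposition 1 (p. 27)] -/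
theorem IsKerMap.exists_coker {A X : Obj p} {i : LinTangent p A.d₀ A.d₁ →ₗ[PadicAlgCl p] LinTangent p X.d₀ X.d₁}
    (hi : A.IsKerMap X i) :
    ∃ (B : Obj p) (s : LinTangent p X.d₀ X.d₁ →ₗ[PadicAlgCl p] LinTangent p B.d₀ B.d₁),
      X.IsCokerMap B s ∧ LinearMap.range i = LinearMap.ker s := by
  obtain ⟨-, hbi, -, -, -⟩ := hi
  obtain ⟨B₀, B₁, hdec⟩ := exists_eq_prodMap_of_isBiRational hbi
  obtain ⟨e₀, T₀, -, hsurj₀, hker₀⟩ := exists_surjective_ker_eq_spanK (F := (padicQbar p)) (K := PadicAlgCl p)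
    (LinearMap.range B₀.mulVecLin)
  obtain ⟨e₁, T₁, -, hsurj₁, hker₁⟩ := exists_surjective_ker_eq_spanK (F := ℚ) (K := PadicAlgCl p)
    (LinearMap.range B₁.mulVecLin)
  have hbr : IsBiRational ((T₀.map (algebraMap (padicQbar p) (PadicAlgCl p))).mulVecLin.prodMap
      (T₁.map (algebraMap ℚ (PadicAlgCl p))).mulVecLin) := isBiRational_prodMap T₀ T₁
  have hs : IsAdmissible ((T₀.map (algebraMap (padicQbar p) (PadicAlgCl p))).mulVecLin.prodMap
      (T₁.map (algebraMap ℚ (PadicAlgCl p))).mulVecLin) := by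
    refine ⟨?_, hbr⟩
    rw [LinearMap.coe_prodMap]
    exact hsurj₀.prodMap hsurj₁
  have hker : LinearMap.range i = LinearMap.ker ((T₀.map (algebraMap (padicQbar p) (PadicAlgCl p))).mulVecLin.prodMap
      (T₁.map (algebraMap ℚ (PadicAlgCl p))).mulVecLin) := by
    rw [hdec, LinearMap.range_prodMap, LinearMap.ker_prodMap, hker₀, hker₁, range_mulVecLin_map,
      range_mulVecLin_map]
  exact ⟨X.mapObj _ hbr, _, X.isCokerMap_mapObj hs, hker⟩

/-- **Proposition 1, second half**: every cokernel `(X, X', s)` admits a kernel `(X*, X, i)` with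
`Im(i) = ker(s)` (`ker(s) = S₀ × S₁` with `S₀, S₁` rational; take `i = i₀ × i₁` with rational
injections onto `S₀, S₁` and `X*` the preimage object). [cite: Roy1992, §2 Proposition 1 (p. 27)] -/
theorem IsCokerMap.exists_ker {X B : Obj p} {s : LinTangent p X.d₀ X.d₁ →ₗ[PadicAlgCl p] LinTangent p B.d₀ B.d₁}
    (hs : X.IsCokerMap B s) :
    ∃ (A : Obj p) (i : LinTangent p A.d₀ A.d₁ →ₗ[PadicAlgCl p] LinTangent p X.d₀ X.d₁),
      A.IsKerMap X i ∧ LinearMap.range i = LinearMap.ker s := by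
  obtain ⟨⟨-, hbi⟩, -, -, -⟩ := hs
  obtain ⟨A₀, A₁, hdec⟩ := exists_eq_prodMap_of_isBiRational hbi
  obtain ⟨a₀, B₀, -, hinj₀, hrange₀⟩ := exists_injective_range_eq_spanK (F := (padicQbar p)) (K := PadicAlgCl p)
    (LinearMap.ker A₀.mulVecLin)
  obtain ⟨a₁, B₁, -, hinj₁, hrange₁⟩ := exists_injective_range_eq_spanK (F := ℚ) (K := PadicAlgCl p)
    (LinearMap.ker A₁.mulVecLin)
  have hinj : Function.Injective
      ((B₀.map (algebraMap (padicQbar p) (PadicAlgCl p))).mulVecLin.prodMap (B₁.map (algebraMap ℚ (PadicAlgCl p))).mulVecLin) := by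
    rw [LinearMap.coe_prodMap]
    exact hinj₀.prodMap hinj₁
  have hbi' : IsBiRational
      ((B₀.map (algebraMap (padicQbar p) (PadicAlgCl p))).mulVecLin.prodMap (B₁.map (algebraMap ℚ (PadicAlgCl p))).mulVecLin) :=
    isBiRational_prodMap B₀ B₁
  have hrange : LinearMap.range
      ((B₀.map (algebraMap (padicQbar p) (PadicAlgCl p))).mulVecLin.prodMap (B₁.map (algebraMap ℚ (PadicAlgCl p))).mulVecLin) =
      LinearMap.ker s := by
    rw [hdec, LinearMap.ker_prodMap, LinearMap.range_prodMap, hrange₀, hrange₁,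
      ker_mulVecLin_map, ker_mulVecLin_map]
  exact ⟨X.comapObj _ hinj hbi', _, X.isKerMap_comapObj hinj hbi', hrange⟩

end Obj

variable (p) in
/-- **Roy's category `𝒞` is admissible** (Proposition 1): the arrow-free admissible category
(`Roy1992.AdmissibleCat`) whose kernels/cokernels are given by the maps `IsKerMap`/`IsCokerMap`
and whose exact triples `(X*, X, X')` are "a kernel `X* → X` admitting as cokernel a morphism
`X → X'`" (`Im(i) = ker(s)`). [cite: Roy1992, §2 Proposition 1 (p. 27) and §3 (p. 29)] -/
def cat : AdmissibleCat (Obj p) where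
  IsKer A X := ∃ i, A.IsKerMap X i
  IsCoker X B := ∃ s, X.IsCokerMap B s
  Exact A X B := ∃ (i : LinTangent p A.d₀ A.d₁ →ₗ[PadicAlgCl p] LinTangent p X.d₀ X.d₁)
    (s : LinTangent p X.d₀ X.d₁ →ₗ[PadicAlgCl p] LinTangent p B.d₀ B.d₁),
    A.IsKerMap X i ∧ X.IsCokerMap B s ∧ LinearMap.range i = LinearMap.ker s
  isKer_refl X := ⟨_, X.isKerMap_id⟩
  isCoker_refl X := ⟨_, X.isCokerMap_id⟩
  isKer_trans := fun ⟨_, hi⟩ ⟨_, hj⟩ => ⟨_, hi.comp hj⟩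
  isCoker_trans := fun ⟨_, hs⟩ ⟨_, ht⟩ => ⟨_, hs.comp ht⟩
  isKer_of_exact := fun ⟨i, _, hi, _, _⟩ => ⟨i, hi⟩
  isCoker_of_exact := fun ⟨_, s, _, hs, _⟩ => ⟨s, hs⟩
  exists_exact_of_isKer := fun ⟨i, hi⟩ => by
    obtain ⟨B, s, hs, h⟩ := hi.exists_coker
    exact ⟨B, i, s, hi, hs, h⟩
  exists_exact_of_isCoker := fun ⟨s, hs⟩ => by
    obtain ⟨A, i, hi, h⟩ := hs.exists_ker
    exact ⟨A, i, s, hi, hs, h⟩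

/-- Kernels of `𝒞`. [folklore] -/
theorem cat_isKer_iff (A X : Obj p) : (cat p).IsKer A X ↔ ∃ i, A.IsKerMap X i := Iff.rfl

/-- Cokernels of `𝒞`. [folklore] -/
theorem cat_isCoker_iff (X B : Obj p) : (cat p).IsCoker X B ↔ ∃ s, X.IsCokerMap B s := Iff.rfl

/-- Exact triples of `𝒞`. [folklore] -/
theorem cat_exact_iff (A X B : Obj p) :
    (cat p).Exact A X B ↔ ∃ (i : LinTangent p A.d₀ A.d₁ →ₗ[PadicAlgCl p] LinTangent p X.d₀ X.d₁)
      (s : LinTangent p X.d₀ X.d₁ →ₗ[PadicAlgCl p] LinTangent p B.d₀ B.d₁),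
      A.IsKerMap X i ∧ X.IsCokerMap B s ∧ LinearMap.range i = LinearMap.ker s := Iff.rfl

end PartB

section PartC

variable {d₀ d₁ d₀' d₁' a₀ a₁ : ℕ}


/-- Exactness is preserved by restricting scalars to `ℚ`. [folklore] -/
theorem range_restrictScalars_rat_eq_ker {i : LinTangent p a₀ a₁ →ₗ[PadicAlgCl p] LinTangent p d₀ d₁}
    {s : LinTangent p d₀ d₁ →ₗ[PadicAlgCl p] LinTangent p d₀' d₁'} (hex : LinearMap.range i = LinearMap.ker s) :
    LinearMap.range (i.restrictScalars ℚ) = LinearMap.ker (s.restrictScalars ℚ) := by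
  ext x
  rw [LinearMap.mem_ker, LinearMap.restrictScalars_apply, ← LinearMap.mem_ker, ← hex,
    LinearMap.mem_range, LinearMap.mem_range]
  rfl

/-! ### Exact triples of `𝒞`: the dimensions -/

namespace Obj

/-- Along an exact triple `(X*, X, X')` the dimensions add: `d₀ = d₀* + d₀'`, `d₁ = d₁* + d₁'`
(blockwise rank–nullity). [cite: Roy1992, §2 Proposition 2 (p. 28)] -/
theorem dims_of_exact {A X B : Obj p} {i : LinTangent p A.d₀ A.d₁ →ₗ[PadicAlgCl p] LinTangent p X.d₀ X.d₁}
    {s : LinTangent p X.d₀ X.d₁ →ₗ[PadicAlgCl p] LinTangent p B.d₀ B.d₁} (hi : A.IsKerMap X i)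
    (hs : X.IsCokerMap B s) (hex : LinearMap.range i = LinearMap.ker s) :
    A.d₀ + B.d₀ = X.d₀ ∧ A.d₁ + B.d₁ = X.d₁ := by
  obtain ⟨hinj, hbi, -, -, -⟩ := hi
  obtain ⟨⟨hsurj, hbs⟩, -, -, -⟩ := hs
  obtain ⟨B₀, B₁, hdi⟩ := exists_eq_prodMap_of_isBiRational hbi
  obtain ⟨A₀, A₁, hds⟩ := exists_eq_prodMap_of_isBiRational hbs
  rw [hdi, hds, LinearMap.range_prodMap, LinearMap.ker_prodMap] at hex
  have hex₀ := congrArg (Submodule.map (LinearMap.fst (PadicAlgCl p) _ _)) hex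
  rw [Submodule.prod_map_fst, Submodule.prod_map_fst] at hex₀
  have hex₁ := congrArg (Submodule.map (LinearMap.snd (PadicAlgCl p) _ _)) hex
  rw [Submodule.prod_map_snd, Submodule.prod_map_snd] at hex₁
  have hinj₀ : Function.Injective (B₀.map (algebraMap (padicQbar p) (PadicAlgCl p))).mulVecLin := by
    intro z z' hzz'
    have : i (z, 0) = i (z', 0) := by
      rw [hdi, LinearMap.prodMap_apply, LinearMap.prodMap_apply, hzz']
    exact congrArg Prod.fst (hinj this)
  have hinj₁ : Function.Injective (B₁.map (algebraMap ℚ (PadicAlgCl p))).mulVecLin := by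
    intro z z' hzz'
    have : i (0, z) = i (0, z') := by
      rw [hdi, LinearMap.prodMap_apply, LinearMap.prodMap_apply, hzz']
    exact congrArg Prod.snd (hinj this)
  have hsurj₀ : Function.Surjective (A₀.map (algebraMap (padicQbar p) (PadicAlgCl p))).mulVecLin := by
    intro z
    obtain ⟨⟨x, y⟩, h⟩ := hsurj (z, 0)
    refine ⟨x, ?_⟩
    rw [hds, LinearMap.prodMap_apply] at h
    exact congrArg Prod.fst h
  have hsurj₁ : Function.Surjective (A₁.map (algebraMap ℚ (PadicAlgCl p))).mulVecLin := by
    intro z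
    obtain ⟨⟨x, y⟩, h⟩ := hsurj (0, z)
    refine ⟨y, ?_⟩
    rw [hds, LinearMap.prodMap_apply] at h
    exact congrArg Prod.snd h
  have r₀ := LinearMap.finrank_range_add_finrank_ker (A₀.map (algebraMap (padicQbar p) (PadicAlgCl p))).mulVecLin
  rw [LinearMap.range_eq_top.2 hsurj₀, finrank_top, ← hex₀,
    LinearMap.finrank_range_of_inj hinj₀] at r₀
  have r₁ := LinearMap.finrank_range_add_finrank_ker (A₁.map (algebraMap ℚ (PadicAlgCl p))).mulVecLin
  rw [LinearMap.range_eq_top.2 hsurj₁, finrank_top, ← hex₁,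
    LinearMap.finrank_range_of_inj hinj₁] at r₁
  simp only [finrank_fin_fun] at r₀ r₁
  omega

/-- Along an exact triple, `dim V = dim V* + dim V'` and `dim W = dim W* + dim W'`.
[cite: Roy1992, §2 proof of Proposition 2 (p. 28)] -/
theorem finrank_VW_of_exact {A X B : Obj p} {i : LinTangent p A.d₀ A.d₁ →ₗ[PadicAlgCl p] LinTangent p X.d₀ X.d₁}
    {s : LinTangent p X.d₀ X.d₁ →ₗ[PadicAlgCl p] LinTangent p B.d₀ B.d₁} (hi : A.IsKerMap X i)
    (hs : X.IsCokerMap B s) (hex : LinearMap.range i = LinearMap.ker s) :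
    finrank (PadicAlgCl p) B.V + finrank (PadicAlgCl p) A.V = finrank (PadicAlgCl p) X.V ∧
      finrank (PadicAlgCl p) B.W + finrank (PadicAlgCl p) A.W = finrank (PadicAlgCl p) X.W := by
  obtain ⟨hinj, -, -, hW, hV⟩ := hi
  obtain ⟨-, -, hW', hV'⟩ := hs
  rw [hV, hW, hV', hW']
  exact ⟨finrank_map_add_finrank_comap i s hinj hex X.V,
    finrank_map_add_finrank_comap i s hinj hex X.W⟩

/-- Along an exact triple, `dim_ℚ Y = dim_ℚ Y* + dim_ℚ Y'`. [cite: Roy1992, §2 proof of Proposition 2 (p. 28)] -/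
theorem finrank_Y_of_exact {A X B : Obj p} {i : LinTangent p A.d₀ A.d₁ →ₗ[PadicAlgCl p] LinTangent p X.d₀ X.d₁}
    {s : LinTangent p X.d₀ X.d₁ →ₗ[PadicAlgCl p] LinTangent p B.d₀ B.d₁} (hi : A.IsKerMap X i)
    (hs : X.IsCokerMap B s) (hex : LinearMap.range i = LinearMap.ker s) :
    finrank ℚ B.Y + finrank ℚ A.Y = finrank ℚ X.Y := by
  obtain ⟨hinj, -, hY, -, -⟩ := hi
  obtain ⟨-, hY', -, -⟩ := hs
  rw [hY, hY']
  exact finrank_map_add_finrank_comap (i.restrictScalars ℚ) (s.restrictScalars ℚ) hinj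
    (range_restrictScalars_rat_eq_ker hex) X.Y

/-! ### Proposition 2 -/

/-- `r = d₀ + d₁` is additive. [cite: Roy1992, §2 Proposition 2 (p. 28)] -/
theorem fr_additive : (cat p).Additive fr := by
  rintro A X B ⟨i, s, hi, hs, hex⟩
  have := dims_of_exact hi hs hex
  unfold fr
  omega

/-- `d₀` is additive. [cite: Roy1992, §2 Proposition 2 (p. 28)] -/
theorem fd₀_additive : (cat p).Additive fd₀ := by
  rintro A X B ⟨i, s, hi, hs, hex⟩
  have := dims_of_exact hi hs hex
  unfold fd₀
  omega

/-- `d₁` is additive. [cite: Roy1992, §2 Proposition 2 (p. 28)] -/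
theorem fd₁_additive : (cat p).Additive fd₁ := by
  rintro A X B ⟨i, s, hi, hs, hex⟩
  have := dims_of_exact hi hs hex
  unfold fd₁
  omega

/-- `b = d₀ + d₁ − dim V` is additive. [cite: Roy1992, §2 Proposition 2 (p. 28)] -/
theorem fb_additive : (cat p).Additive fb := by
  rintro A X B ⟨i, s, hi, hs, hex⟩
  have h1 := dims_of_exact hi hs hex
  have h2 := (finrank_VW_of_exact hi hs hex).1
  have h3 := A.finrank_V_le
  have h4 := B.finrank_V_le
  unfold fb
  omega

/-- `c = dim_ℚ Y` is additive. [cite: Roy1992, §2 Proposition 2 (p. 28)] -/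
theorem fc_additive : (cat p).Additive fc := by
  rintro A X B ⟨i, s, hi, hs, hex⟩
  have := finrank_Y_of_exact hi hs hex
  unfold fc
  omega

/-- `d = dim V − dim W` is additive. [cite: Roy1992, §2 Proposition 2 (p. 28)] -/
theorem fd_additive : (cat p).Additive fd := by
  rintro A X B ⟨i, s, hi, hs, hex⟩
  have h1 := finrank_VW_of_exact hi hs hex
  have h3 := A.finrank_W_le
  have h4 := B.finrank_W_le
  have h5 := X.finrank_W_le
  unfold fd
  omega

/-- `a = d₁ − dim_ℚ(Y ∩ Ω)` is upper additive (for the `p`-adic field `a = d₁` is even additive).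
[cite: Roy1992, §2 Proposition 2 (p. 28)] -/
theorem fa_upperAdditive : (cat p).UpperAdditive fa :=
  fun _ _ _ hE => (fd₁_additive hE).ge

/-- `a, b, c, d` vanish where `r` vanishes (`d₀ = d₁ = 0`: the ambient space is zero).
[cite: Roy1992, §2 Proposition 2 (p. 28)] -/
theorem vanish (X : Obj p) (hr : fr X = 0) : fa X = 0 ∧ fb X = 0 ∧ fc X = 0 ∧ fd X = 0 := by
  have hd₀ : X.d₀ = 0 := by unfold fr at hr; omega
  have hd₁ : X.d₁ = 0 := by unfold fr at hr; omega
  have h0 : ∀ v : LinTangent p X.d₀ X.d₁, v = 0 := fun v =>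
    Prod.ext (funext fun k => (Fin.cast hd₀ k).elim0) (funext fun k => (Fin.cast hd₁ k).elim0)
  have hY : X.Y = ⊥ := (Submodule.eq_bot_iff _).2 fun v _ => h0 v
  have hV : X.V = ⊥ := (Submodule.eq_bot_iff _).2 fun v _ => h0 v
  refine ⟨?_, ?_, ?_, ?_⟩
  · unfold fa; exact hd₁
  · unfold fb; omega
  · unfold fc; rw [hY, finrank_bot]
  · unfold fd; rw [hV, finrank_bot]; omega

/-- **Proposition 2** as the hypotheses of Theorem 3 for `(𝒞, a, b, c, d, r)`.
[cite: Roy1992, §2 Proposition 2 (p. 28); §3 proof of Theorem 2bis (p. 32)] -/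
theorem thm3Hyp : (cat p).Thm3Hyp fa fb fc fd fr where
  ha := fa_upperAdditive
  hb := fb_additive
  hc := fc_additive
  hd := fun _ _ _ hE => (fd_additive hE).ge
  hr := fr_additive
  vanish := vanish

/-! ### Proposition 3 -/

/-- **Proposition 3**: "For each object `X` of `𝒞`, there exists a cokernel `s : X → X'` with
domain `X` such that `d₁(X') ≤ a(X)` and `b(X') = b(X)`." For the `p`-adic field `a = d₁` and the
identity cokernel will do (in print `s = id × t₁` with `t₁` a rational surjection of kernel
`K·(V ∩ (0 × ℚ^{d₁}))`, needed only when `ω ≠ 0`). [cite: Roy1992, §2 Proposition 3 (pp. 28–29)] -/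
theorem prop3 (X : Obj p) : ∃ X', (cat p).IsCoker X X' ∧ fd₁ X' ≤ fa X ∧ fb X' = fb X :=
  ⟨X, (cat p).isCoker_refl X, le_rfl, rfl⟩

/-! ### Theorem 1bis -/

/-- **Theorem 1bis**: Statement 1 of Theorem 3 holds for `(𝒞, a, b, c, d, r)` — it is Theorem 1
(here the HYPOTHESIS `IsThmOneDatum → ThmOneConclusion`).
[cite: Roy1992, §2 Theorem 1bis (p. 27); §3 proof of Theorem 2bis (p. 32)] -/
theorem statement1_of_thmOne
    (h : ∀ ⦃d₀ d₁ : ℕ⦄ (Y : Submodule ℚ (LinTangent p d₀ d₁))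
      (W V : Submodule (PadicAlgCl p) (LinTangent p d₀ d₁)),
      IsThmOneDatum Y W V → V ≠ ⊤ → ThmOneConclusion Y W V) :
    (cat p).Statement1 fa fb fc fd fr := by
  intro X hb
  obtain ⟨d₀', d₁', s, hs, hne, hineq⟩ := exists_mapObj_of_thmOne h X hb
  exact ⟨X.mapObj s hs.2, ⟨s, X.isCokerMap_mapObj hs⟩, hne, hineq⟩

end Obj

end PartC
/-! ### Theorem 2 from Theorem 1 [Roy1992, §3 pp. 32–34] -/

/-- **Roy 1992, Theorem 2 from Theorem 1 for `K = ℚ̄_p`** (the hypothesis "Theorem 1" gives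
`ThmTwoConclusion Y W V` for every datum with `V ≠ K^{d₀} × K^{d₁}`), following the printed proof and
its complex-case formalization `Literature.Barriers.Schanuel.roy1992_thm2_of_thm1`: in Roy's category `𝒞` (§2; `Roy1992.cat`, Propositions 1–3) Theorem 1 is Statement 1 of
Theorem 3 (`statement1_of_thm1`), so Theorem 3 gives Statement 2′ and Theorem 2bis
(`Roy1992.AdmissibleCat.thm2bis`), which is Theorem 2 once the cokernels of `𝒞` are read as the
admissible maps `s`, the ratio `d₁(X')/b(X')` as `d₁'/(d₀' + d₁' − dim_K(s(V)))`, and the kernel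
condition as `s(V) ∩ (ℚ̄^{d₀'} × 0) = 0` (`Obj.isThm2Minimal_iff`, `Obj.noBadKernel_iff`); `Ω = 0`.
[cite: Roy1992, §1 Theorem 2 (p. 25); §2 Theorem 2bis (p. 27); §3 proof of Theorem 2bis (pp. 32–34)] -/
theorem thmTwo_of_thmOne
    (h : ∀ ⦃d₀ d₁ : ℕ⦄ (Y : Submodule ℚ (LinTangent p d₀ d₁))
      (W V : Submodule (PadicAlgCl p) (LinTangent p d₀ d₁)),
      IsThmOneDatum Y W V → V ≠ ⊤ → ThmOneConclusion Y W V)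
    {d₀ d₁ : ℕ} {Y : Submodule ℚ (LinTangent p d₀ d₁)} {W V : Submodule (PadicAlgCl p) (LinTangent p d₀ d₁)}
    (hX : IsThmOneDatum Y W V) (hV : V ≠ ⊤) : ThmTwoConclusion Y W V := by
  obtain ⟨hfin, hlog, hrat, hYV, hWV⟩ := hX
  let X : Obj p := ⟨d₀, d₁, Y, W, V, hfin, hlog, hrat, hYV, hWV⟩
  have hb : fb X ≠ 0 := (Obj.fb_ne_zero_iff X).2 hV
  obtain ⟨⟨X', ⟨⟨s, hs⟩, hb', hmin⟩, hno⟩, hall⟩ :=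
    AdmissibleCat.thm2bis (𝒞 := cat p) Obj.thm3Hyp Obj.fd₁_additive Obj.fa_le_fd₁ Obj.prop3
      (Obj.statement1_of_thmOne h) X hb
  refine ⟨⟨X'.d₀, X'.d₁, s, ?_, ?_⟩, ?_⟩
  · exact hs.isThm2Minimal_iff.2 ⟨hb', fun X'' s'' hs'' hb'' => hmin X'' ⟨s'', hs''⟩ hb''⟩
  · have hV' : V.map s = X'.V := hs.2.2.2.symm
    rw [hV']
    refine (Obj.noBadKernel_iff X').1 ?_
    rintro ⟨A, i, hi, h1, h2, h3⟩
    exact hno ⟨A, ⟨i, hi⟩, h1, h2, h3⟩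
  · intro d₀' d₁' s hmin htriv
    have hbr : IsBiRational s := hmin.1.2
    have hsc : X.IsCokerMap (X.mapObj s hbr) s := X.isCokerMap_mapObj hmin.1
    obtain ⟨hb', hmin'⟩ := hsc.isThm2Minimal_iff.1 hmin
    have hno : ¬ ∃ A, (cat p).IsKer A (X.mapObj s hbr) ∧ fd₁ A = 0 ∧ fb A = 0 ∧ fr A ≠ 0 := by
      rintro ⟨A, ⟨i, hi⟩, h1, h2, h3⟩
      exact (Obj.noBadKernel_iff (X.mapObj s hbr)).2 htriv ⟨A, i, hi, h1, h2, h3⟩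
    obtain ⟨hle1, hle2⟩ := hall (X.mapObj s hbr) ⟨s, hsc⟩ hb'
      (fun X'' ⟨s'', hs''⟩ hb'' => hmin' X'' s'' hs'' hb'') hno
    rw [← Obj.thm2Ratio_eq hsc] at hle1 hle2
    refine ⟨?_, ?_⟩
    · rw [Obj.cast_fb_add_fd] at hle1
      exact hle1
    · rw [Obj.cast_fa, Obj.cast_fb] at hle2
      exact hle2

end Literature.NumberTheory.Transcendental.RoyPadic
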